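import Literature.Geometry.Lorentzian.KerrConvergenceProofs
import HarnessLib

/-!
# The `N`-centre boosted Kerr–Schild superposition (multi-black-hole reference background)

The **superposed Kerr–Schild form** of `N` boosted, translated Kerr black holes with motions
`(Λᵢ, cᵢ) ∈ O(1,3) ⋉ ℝ⁴`, masses `Mᵢ` and specific angular momenta `aᵢ`:

  `g(x) = η + ∑ᵢ (g_{Mᵢ,aᵢ,Λᵢ,cᵢ}(x) − η) = η + ∑ᵢ 2Hᵢ ℓ⁽ⁱ⁾ ⊗ ℓ⁽ⁱ⁾`,

where `g_{M,a,Λ,c} = boostedKerrBilin Λ c M a` is the boosted Kerr–Schild form of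
`KerrConvergence.lean` (Kerr–Schild 1965: the Kerr–Schild ansatz `η + 2H ℓ ⊗ ℓ` is Lorentz
covariant). This is the "superposed Kerr–Schild" background of numerical relativity
(Matzner–Huq–Shoemaker, PRD 59 (1998) 024015, §3 eq. (15) and §5; Bonning–Marronetti–Neilsen–Matzner,
PRD 68 (2003) 044019, §3.3, with all attenuation functions `≡ 1`), used as the far-zone skeleton of
multi-black-hole Cauchy data. **It is a reference background, not a solution**: linearity of the
Kerr–Schild ansatz is *not* claimed (the superposition violates the constraints; Bonning et al. §3.3).

## Contents

* `multiCentreKerrSchildBilin mot M a x` (total on `E4`; only its values off the boosted horizons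
  matter), the unfolding lemma `multiCentreKerrSchildBilin_apply`, symmetry, `N = 0` gives `η`
  (`multiCentreKerrSchildBilin_zero`), `N = 1` gives `boostedKerrBilin` (`multiCentreKerrSchildBilin_one`);
* the **late-time domain** `multiCentreLateDomain mot M a = {x | ∀ i, r₊(Mᵢ,aᵢ) < rᵢ(Λᵢ⁻¹(x − cᵢ))}`
  and the **far domain** `multiCentreFarDomain mot a ρ = {x | ∀ i, ρ < rᵢ(Λᵢ⁻¹(x − cᵢ))}` as
  `Opens E4`, with their relation to the boosted Kerr exteriors;
* **asymptotic flatness of the superposition, uniformly outside tubes** (proved, not vendored):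
  `‖g(x) − η‖ ≤ ∑ᵢ ‖Λᵢ⁻¹‖² ‖g_{Mᵢ,aᵢ}(Λᵢ⁻¹(x − cᵢ)) − η‖`
  (`norm_multiCentreKerrSchildBilin_sub_minkowski_le`) and, from the `O(M/r)` decay of the
  Kerr–Schild term (`Kerr.norm_iteratedFDeriv_ksPert_le`, Kerr–Schild 1965 §3), for every `ε > 0`
  a radius `ρ₀` with `‖g(x) − η‖ ≤ ε` whenever all rest-frame radii exceed `ρ₀`
  (`exists_norm_multiCentreKerrSchildBilin_sub_minkowski_le`);
* **Lorentzian signature far out** (proved): a symmetric bilinear form on `E4` with `‖g − η‖ < 1`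
  is a Lorentzian scalar product (`Minkowski.apply_self_pos_of_norm_sub_bilin_lt_one`,
  `Minkowski.pos_of_orthogonal_of_spatial_pos`, `Minkowski.nondegenerate_of_spatial_pos`;
  O'Neill 1983, Ch. 5, Lemma 5.26 in perturbative form), whence the real-analytic Lorentzian metric
  `multiCentreKerrSchildMetric mot M a ρ` on `multiCentreFarDomain mot a ρ` for every `ρ ≥ 0` past
  which `‖g − η‖ < 1`, such `ρ` existing by `exists_forall_mem_multiCentreFarDomain_norm_sub_lt_one`;
  the late-time phrasing "for `x⁰` large, outside tubes of radii `ρᵢ(x⁰) → ∞` around the centres"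
  is `exists_forall_norm_sub_minkowski_lt_one_of_tendsto`. No hypothesis on the 4-velocities is
  needed for the signature (pairwise distinct velocities only serve to make the tubes disjoint at
  late times, cf. `FinalStateDecomposition.exists_pairwise_disjoint`).

## References

* R. P. Kerr, A. Schild, *A new class of vacuum solutions of the Einstein field equations* (1965),
  §2–§3 (key `KerrSchild1965`).
* R. A. Matzner, M. F. Huq, D. Shoemaker, *Initial data and coordinates for multiple black hole
  systems*, Phys. Rev. D 59 (1998) 024015, §3 (15), §5 (key `MatznerHuqShoemaker1998`).
* E. Bonning, P. Marronetti, D. Neilsen, R. Matzner, *Physics and initial data for multiple black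
  hole spacetimes*, Phys. Rev. D 68 (2003) 044019, §3.3 (key `BonningEtAl2003`).
* B. O'Neill, *Semi-Riemannian geometry*, Academic Press 1983, Ch. 5, Lemma 5.26 (key `ONeill1983`).
-/

noncomputable section

open TopologicalSpace Filter
open scoped ContDiff Manifold Topology

namespace Literature.Geometry.Lorentzian

variable {N : ℕ}

/-! ### The superposed form -/

/-- The **`N`-centre boosted Kerr–Schild superposition**
`g(x) = η + ∑ᵢ (g_{Mᵢ,aᵢ,Λᵢ,cᵢ}(x) − η) = η + ∑ᵢ 2Hᵢ ℓ⁽ⁱ⁾ ⊗ ℓ⁽ⁱ⁾` of the boosted, translated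
Kerr–Schild forms `boostedKerrBilin Λᵢ cᵢ Mᵢ aᵢ` with motions `mot i = (Λᵢ, cᵢ)`, as a continuous
bilinear form on `E4` at every point `x` (total; only its values off the boosted horizons, e.g. on
`multiCentreLateDomain`, are meaningful). A reference background, not a solution of the vacuum
equations. Matzner–Huq–Shoemaker 1998, §5; Bonning–Marronetti–Neilsen–Matzner 2003, §3.3
(attenuation functions `≡ 1`). [cite: BonningEtAl2003, §3.3] -/
def multiCentreKerrSchildBilin (mot : Fin N → lorentzGroup × E4) (M a : Fin N → ℝ) (x : E4) :
    E4 →L[ℝ] E4 →L[ℝ] ℝ :=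
  Minkowski.bilin + ∑ i, (boostedKerrBilin (mot i).1 (mot i).2 (M i) (a i) x - Minkowski.bilin)

/-- Unfolding lemma: `g(x)(v, w) = η(v, w) + ∑ᵢ (g_{Mᵢ,aᵢ,Λᵢ,cᵢ}(x)(v, w) − η(v, w))`
(Bonning et al. 2003, §3.3). [cite: BonningEtAl2003, §3.3] -/
theorem multiCentreKerrSchildBilin_apply (mot : Fin N → lorentzGroup × E4) (M a : Fin N → ℝ)
    (x v w : E4) :
    multiCentreKerrSchildBilin mot M a x v w =
      Minkowski.bilin v w +
        ∑ i, (boostedKerrBilin (mot i).1 (mot i).2 (M i) (a i) x v w - Minkowski.bilin v w) := by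
  simp only [multiCentreKerrSchildBilin, add_apply, sum_apply, sub_apply]

/-- The perturbation `g(x) − η = ∑ᵢ (g_{Mᵢ,aᵢ,Λᵢ,cᵢ}(x) − η)` is the sum of the individual
Kerr–Schild terms (Bonning et al. 2003, §3.3). [cite: BonningEtAl2003, §3.3] -/
theorem multiCentreKerrSchildBilin_sub_minkowski (mot : Fin N → lorentzGroup × E4)
    (M a : Fin N → ℝ) (x : E4) :
    multiCentreKerrSchildBilin mot M a x - Minkowski.bilin =
      ∑ i, (boostedKerrBilin (mot i).1 (mot i).2 (M i) (a i) x - Minkowski.bilin) := by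
  ext v w
  simp only [sub_apply, sum_apply, multiCentreKerrSchildBilin_apply]
  ring

/-- The boosted Kerr–Schild form is symmetric (Kerr–Schild 1965). [cite: KerrSchild1965, §2] -/
theorem boostedKerrBilin_symm (Λ : lorentzGroup) (c : E4) (M a : ℝ) (x v w : E4) :
    boostedKerrBilin Λ c M a x v w = boostedKerrBilin Λ c M a x w v := by
  rw [boostedKerrBilin_apply, boostedKerrBilin_apply, Kerr.bilin_symm]

/-- The superposed form is symmetric (Bonning et al. 2003, §3.3). [cite: BonningEtAl2003, §3.3] -/
theorem multiCentreKerrSchildBilin_symm (mot : Fin N → lorentzGroup × E4) (M a : Fin N → ℝ)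
    (x v w : E4) :
    multiCentreKerrSchildBilin mot M a x v w = multiCentreKerrSchildBilin mot M a x w v := by
  rw [multiCentreKerrSchildBilin_apply, multiCentreKerrSchildBilin_apply, Minkowski.bilin_symm v w]
  refine congrArg _ (Finset.sum_congr rfl fun i _ ↦ ?_)
  rw [boostedKerrBilin_symm]

/-- `N = 0`: with no centre the superposed form is the Minkowski form `η`
(Bonning et al. 2003, §3.3). [cite: BonningEtAl2003, §3.3] -/
@[simp]
theorem multiCentreKerrSchildBilin_zero (mot : Fin 0 → lorentzGroup × E4) (M a : Fin 0 → ℝ)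
    (x : E4) : multiCentreKerrSchildBilin mot M a x = Minkowski.bilin := by
  simp [multiCentreKerrSchildBilin]

/-- `N = 1`: with one centre the superposed form is the boosted Kerr–Schild form
`boostedKerrBilin Λ₀ c₀ M₀ a₀` (Matzner–Huq–Shoemaker 1998, §3 (15)). [cite: MatznerHuqShoemaker1998, §3 (15)] -/
@[simp]
theorem multiCentreKerrSchildBilin_one (mot : Fin 1 → lorentzGroup × E4) (M a : Fin 1 → ℝ)
    (x : E4) :
    multiCentreKerrSchildBilin mot M a x = boostedKerrBilin (mot 0).1 (mot 0).2 (M 0) (a 0) x := by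
  ext v w
  rw [multiCentreKerrSchildBilin_apply, Fin.sum_univ_one]
  ring

/-! ### Domains -/

/-- The **late-time domain** of the superposition: the points whose rest-frame Kerr–Schild
radius with respect to every centre exceeds that centre's outer horizon radius,
`{x | ∀ i, r₊(Mᵢ, aᵢ) < rᵢ(Λᵢ⁻¹(x − cᵢ))}`, an open subset of `E4`. For `0 ≤ Mᵢ` this is the
intersection of the boosted Kerr exteriors (`mem_multiCentreLateDomain_iff_of_nonneg`); it is
the region outside all background horizons, on which superposed Kerr–Schild data are set
(Matzner–Huq–Shoemaker 1998, §5: boundary conditions at the background horizons). [cite: MatznerHuqShoemaker1998, §5] -/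
def multiCentreLateDomain (mot : Fin N → lorentzGroup × E4) (M a : Fin N → ℝ) : Opens E4 :=
  ⟨{x | ∀ i, Kerr.rPlus (M i) (a i) < Kerr.radius (a i) (poincareInv (mot i).1 (mot i).2 x)}, by
    rw [Set.setOf_forall]
    exact isOpen_iInter_of_finite fun i ↦ isOpen_lt continuous_const
      ((Kerr.continuous_radius (a i)).comp (continuous_poincareInv _ _))⟩

/-- Membership in the late-time domain (Matzner–Huq–Shoemaker 1998, §5). [cite: MatznerHuqShoemaker1998, §5] -/
@[simp]
theorem mem_multiCentreLateDomain {mot : Fin N → lorentzGroup × E4} {M a : Fin N → ℝ} {x : E4} :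
    x ∈ multiCentreLateDomain mot M a ↔
      ∀ i, Kerr.rPlus (M i) (a i) < Kerr.radius (a i) (poincareInv (mot i).1 (mot i).2 x) :=
  Iff.rfl

/-- A point of every boosted Kerr exterior lies in the late-time domain (`max r₊ 0 < r` gives
`r₊ < r`). Bonning et al. 2003, §3.3. [cite: BonningEtAl2003, §3.3] -/
theorem mem_multiCentreLateDomain_of_forall_mem_boostedKerrExterior
    {mot : Fin N → lorentzGroup × E4} {M a : Fin N → ℝ} {x : E4}
    (h : ∀ i, x ∈ boostedKerrExterior (mot i).1 (mot i).2 (M i) (a i)) :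
    x ∈ multiCentreLateDomain mot M a :=
  fun i ↦ Kerr.lt_radius_of_mem_region (h i)

/-- For nonnegative masses (`0 ≤ Mᵢ`, so `0 ≤ r₊(Mᵢ, aᵢ)`) the late-time domain is exactly the
intersection of the boosted Kerr exteriors `boostedKerrExterior Λᵢ cᵢ Mᵢ aᵢ`.
Bonning et al. 2003, §3.3. [cite: BonningEtAl2003, §3.3] -/
theorem mem_multiCentreLateDomain_iff_of_nonneg {mot : Fin N → lorentzGroup × E4}
    {M a : Fin N → ℝ} (hM : ∀ i, 0 ≤ M i) {x : E4} :
    x ∈ multiCentreLateDomain mot M a ↔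
      ∀ i, x ∈ boostedKerrExterior (mot i).1 (mot i).2 (M i) (a i) := by
  refine forall_congr' fun i ↦ ?_
  have h0 : 0 ≤ Kerr.rPlus (M i) (a i) := add_nonneg (hM i) (Real.sqrt_nonneg _)
  rw [mem_boostedKerrExterior, Kerr.mem_exterior, max_eq_left h0]

/-- The **far domain** of the superposition at radius `ρ`: the points whose rest-frame
Kerr–Schild radius with respect to every centre exceeds `ρ`, `{x | ∀ i, ρ < rᵢ(Λᵢ⁻¹(x − cᵢ))}`
(the complement of the tubes of radius `ρ` around the centres' world-lines), an open subset of
`E4`. Bonning et al. 2003, §3.3 ("widely separated" holes). [cite: BonningEtAl2003, §3.3] -/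
def multiCentreFarDomain (mot : Fin N → lorentzGroup × E4) (a : Fin N → ℝ) (ρ : ℝ) : Opens E4 :=
  ⟨{x | ∀ i, ρ < Kerr.radius (a i) (poincareInv (mot i).1 (mot i).2 x)}, by
    rw [Set.setOf_forall]
    exact isOpen_iInter_of_finite fun i ↦ isOpen_lt continuous_const
      ((Kerr.continuous_radius (a i)).comp (continuous_poincareInv _ _))⟩

/-- Membership in the far domain (Bonning et al. 2003, §3.3). [cite: BonningEtAl2003, §3.3] -/
@[simp]
theorem mem_multiCentreFarDomain {mot : Fin N → lorentzGroup × E4} {a : Fin N → ℝ} {ρ : ℝ}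
    {x : E4} :
    x ∈ multiCentreFarDomain mot a ρ ↔
      ∀ i, ρ < Kerr.radius (a i) (poincareInv (mot i).1 (mot i).2 x) :=
  Iff.rfl

/-- The far domains decrease in the radius (Bonning et al. 2003, §3.3). [cite: BonningEtAl2003, §3.3] -/
theorem multiCentreFarDomain_anti (mot : Fin N → lorentzGroup × E4) (a : Fin N → ℝ) {ρ ρ' : ℝ}
    (h : ρ ≤ ρ') : multiCentreFarDomain mot a ρ' ≤ multiCentreFarDomain mot a ρ :=
  fun _ hx i ↦ h.trans_lt (hx i)

/-- Past all the horizon radii the far domain lies in the late-time domain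
(Bonning et al. 2003, §3.3). [cite: BonningEtAl2003, §3.3] -/
theorem multiCentreFarDomain_le_lateDomain (mot : Fin N → lorentzGroup × E4) (M a : Fin N → ℝ)
    {ρ : ℝ} (h : ∀ i, Kerr.rPlus (M i) (a i) ≤ ρ) :
    multiCentreFarDomain mot a ρ ≤ multiCentreLateDomain mot M a :=
  fun _ hx i ↦ (h i).trans_lt (hx i)

/-! ### Asymptotic flatness of the superposition, uniformly outside tubes -/

/-- The boosted Kerr–Schild perturbation is the Lorentz-transformed rest-frame perturbation:
`(g_{M,a,Λ,c}(x) − η)(v, w) = (g_{M,a} − η)(Λ⁻¹(x − c))(Λ⁻¹v, Λ⁻¹w)`, because `Λ⁻¹` preserves `η`.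
Kerr–Schild 1965 (Lorentz covariance); Matzner–Huq–Shoemaker 1998, §3 (15). [cite: MatznerHuqShoemaker1998, §3 (15)] -/
theorem boostedKerrBilin_sub_minkowski_apply (Λ : lorentzGroup) (c : E4) (M a : ℝ) (x v w : E4) :
    (boostedKerrBilin Λ c M a x - Minkowski.bilin) v w =
      (Kerr.bilin M a (poincareInv Λ c x) - Minkowski.bilin)
        ((Λ : E4 ≃L[ℝ] E4).symm v) ((Λ : E4 ≃L[ℝ] E4).symm w) := by
  have hη : Minkowski.bilin ((Λ : E4 ≃L[ℝ] E4).symm v) ((Λ : E4 ≃L[ℝ] E4).symm w) =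
      Minkowski.bilin v w := by
    have h := mem_lorentzGroup_iff.mp Λ.2 ((Λ : E4 ≃L[ℝ] E4).symm v) ((Λ : E4 ≃L[ℝ] E4).symm w)
    rw [ContinuousLinearEquiv.apply_symm_apply, ContinuousLinearEquiv.apply_symm_apply] at h
    exact h.symm
  simp only [sub_apply, boostedKerrBilin_apply, hη]

/-- **Operator-norm bound for one boosted centre**:
`‖g_{M,a,Λ,c}(x) − η‖ ≤ ‖Λ⁻¹‖² ‖g_{M,a}(Λ⁻¹(x − c)) − η‖` (Euclidean operator norms on `E4`).
Matzner–Huq–Shoemaker 1998, §3 (15). [cite: MatznerHuqShoemaker1998, §3 (15)] -/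
theorem norm_boostedKerrBilin_sub_minkowski_le (Λ : lorentzGroup) (c : E4) (M a : ℝ) (x : E4) :
    ‖boostedKerrBilin Λ c M a x - Minkowski.bilin‖ ≤
      ‖((Λ : E4 ≃L[ℝ] E4).symm : E4 →L[ℝ] E4)‖ ^ 2 *
        ‖Kerr.bilin M a (poincareInv Λ c x) - Minkowski.bilin‖ := by
  refine ContinuousLinearMap.opNorm_le_bound₂ _ (by positivity) fun v w ↦ ?_
  rw [boostedKerrBilin_sub_minkowski_apply]
  set L : E4 →L[ℝ] E4 := ((Λ : E4 ≃L[ℝ] E4).symm : E4 →L[ℝ] E4) with hL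
  set K : E4 →L[ℝ] E4 →L[ℝ] ℝ := Kerr.bilin M a (poincareInv Λ c x) - Minkowski.bilin with hK
  have hv : ‖L v‖ ≤ ‖L‖ * ‖v‖ := L.le_opNorm v
  have hw : ‖L w‖ ≤ ‖L‖ * ‖w‖ := L.le_opNorm w
  have hKvw : ‖K (L v) (L w)‖ ≤ ‖K‖ * ‖L v‖ * ‖L w‖ := K.le_opNorm₂ (L v) (L w)
  have hK0 : 0 ≤ ‖K‖ := norm_nonneg K
  have hL0 : 0 ≤ ‖L‖ := norm_nonneg L
  have h1 : ‖K‖ * ‖L v‖ * ‖L w‖ ≤ ‖K‖ * (‖L‖ * ‖v‖) * (‖L‖ * ‖w‖) :=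
    mul_le_mul (mul_le_mul_of_nonneg_left hv hK0) hw (norm_nonneg _) (by positivity)
  calc ‖K (L v) (L w)‖ ≤ ‖K‖ * (‖L‖ * ‖v‖) * (‖L‖ * ‖w‖) := hKvw.trans h1
    _ = ‖L‖ ^ 2 * ‖K‖ * ‖v‖ * ‖w‖ := by ring

/-- **Operator-norm bound for the superposition**:
`‖g(x) − η‖ ≤ ∑ᵢ ‖Λᵢ⁻¹‖² ‖g_{Mᵢ,aᵢ}(Λᵢ⁻¹(x − cᵢ)) − η‖` (triangle inequality over the centres).
Bonning et al. 2003, §3.3. [cite: BonningEtAl2003, §3.3] -/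
theorem norm_multiCentreKerrSchildBilin_sub_minkowski_le (mot : Fin N → lorentzGroup × E4)
    (M a : Fin N → ℝ) (x : E4) :
    ‖multiCentreKerrSchildBilin mot M a x - Minkowski.bilin‖ ≤
      ∑ i, ‖(((mot i).1 : E4 ≃L[ℝ] E4).symm : E4 →L[ℝ] E4)‖ ^ 2 *
        ‖Kerr.bilin (M i) (a i) (poincareInv (mot i).1 (mot i).2 x) - Minkowski.bilin‖ := by
  rw [multiCentreKerrSchildBilin_sub_minkowski]
  refine (norm_sum_le Finset.univ fun i ↦
    boostedKerrBilin (mot i).1 (mot i).2 (M i) (a i) x - Minkowski.bilin).trans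
    (Finset.sum_le_sum fun i _ ↦ ?_)
  exact norm_boostedKerrBilin_sub_minkowski_le (mot i).1 (mot i).2 (M i) (a i) x

/-- **Decay of the Kerr–Schild perturbation** in operator norm: `‖g_{M,a}(x) − η‖ ≤ C / r(x)` for
`r(x) ≥ R` (the order-zero case of `Kerr.norm_iteratedFDeriv_ksPert_le`). Kerr–Schild 1965, §3
(asymptotic flatness of the Kerr–Schild form). [cite: KerrSchild1965, §3] -/
theorem Kerr.exists_norm_ksPert_le (M a : ℝ) :
    ∃ C R : ℝ, 0 < R ∧ ∀ x : E4, R ≤ Kerr.radius a x →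
      ‖Kerr.bilin M a x - Minkowski.bilin‖ ≤ C / Kerr.radius a x := by
  obtain ⟨C, R, hR, h⟩ := Kerr.norm_iteratedFDeriv_ksPert_le M a 0
  refine ⟨C, R, hR, fun x hx ↦ ?_⟩
  have h' := h x hx
  rw [norm_iteratedFDeriv_zero] at h'
  exact h'

/-- **The superposition is uniformly close to `η` outside large tubes**: for every `ε > 0` there
is `ρ₀ > 0` such that `‖g(x) − η‖ ≤ ε` at every point whose rest-frame radii with respect to all
centres exceed `ρ₀`. From the `O(Mᵢ/rᵢ)` decay of each Kerr–Schild term (Kerr–Schild 1965, §3)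
and `norm_multiCentreKerrSchildBilin_sub_minkowski_le`; this is the sense in which the superposed
background is "close to flat when the holes are widely separated" (Bonning et al. 2003, §3.3). [cite: BonningEtAl2003, §3.3] -/
theorem exists_norm_multiCentreKerrSchildBilin_sub_minkowski_le (mot : Fin N → lorentzGroup × E4)
    (M a : Fin N → ℝ) {ε : ℝ} (hε : 0 < ε) :
    ∃ ρ₀ : ℝ, 0 < ρ₀ ∧ ∀ x ∈ multiCentreFarDomain mot a ρ₀,
      ‖multiCentreKerrSchildBilin mot M a x - Minkowski.bilin‖ ≤ ε := by
  choose C R hR hCR using fun i ↦ Kerr.exists_norm_ksPert_le (M i) (a i)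
  -- `S = ∑ᵢ ‖Λᵢ⁻¹‖² max(Cᵢ, 0) ≥ 0` and `ρ₀ = 1 + ∑ᵢ Rᵢ + S / ε`
  obtain ⟨S, hSdef⟩ : ∃ S : ℝ,
      S = ∑ i, ‖(((mot i).1 : E4 ≃L[ℝ] E4).symm : E4 →L[ℝ] E4)‖ ^ 2 * max (C i) 0 :=
    ⟨_, rfl⟩
  have hS0 : 0 ≤ S := by
    rw [hSdef]
    exact Finset.sum_nonneg fun i _ ↦ by positivity
  have hRs : 0 ≤ ∑ i, R i := Finset.sum_nonneg fun i _ ↦ (hR i).le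
  have hSε : 0 ≤ S / ε := div_nonneg hS0 hε.le
  have hρ0 : 0 < 1 + ∑ i, R i + S / ε := by linarith
  refine ⟨1 + ∑ i, R i + S / ε, hρ0, fun x hx ↦ ?_⟩
  have hRi : ∀ i, R i ≤ Kerr.radius (a i) (poincareInv (mot i).1 (mot i).2 x) := fun i ↦ by
    have h1 : R i ≤ ∑ j, R j :=
      Finset.single_le_sum (fun j _ ↦ (hR j).le) (Finset.mem_univ i)
    have h2 := (hx i).le
    linarith
  calc ‖multiCentreKerrSchildBilin mot M a x - Minkowski.bilin‖
      ≤ ∑ i, ‖(((mot i).1 : E4 ≃L[ℝ] E4).symm : E4 →L[ℝ] E4)‖ ^ 2 *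
          ‖Kerr.bilin (M i) (a i) (poincareInv (mot i).1 (mot i).2 x) - Minkowski.bilin‖ :=
        norm_multiCentreKerrSchildBilin_sub_minkowski_le mot M a x
    _ ≤ ∑ i, ‖(((mot i).1 : E4 ≃L[ℝ] E4).symm : E4 →L[ℝ] E4)‖ ^ 2 * max (C i) 0 /
          (1 + ∑ i, R i + S / ε) := by
        refine Finset.sum_le_sum fun i _ ↦ ?_
        rw [mul_div_assoc]
        refine mul_le_mul_of_nonneg_left ?_ (by positivity)
        calc ‖Kerr.bilin (M i) (a i) (poincareInv (mot i).1 (mot i).2 x) - Minkowski.bilin‖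
            ≤ C i / Kerr.radius (a i) (poincareInv (mot i).1 (mot i).2 x) := hCR i _ (hRi i)
          _ ≤ max (C i) 0 / Kerr.radius (a i) (poincareInv (mot i).1 (mot i).2 x) :=
              div_le_div_of_nonneg_right (le_max_left _ _) (Kerr.radius_nonneg _ _)
          _ ≤ max (C i) 0 / (1 + ∑ i, R i + S / ε) :=
              div_le_div_of_nonneg_left (le_max_right _ _) hρ0 (hx i).le
    _ = S / (1 + ∑ i, R i + S / ε) := by rw [← Finset.sum_div, ← hSdef]
    _ ≤ ε := by
        rw [div_le_iff₀ hρ0, mul_add, mul_add, mul_one, mul_div_cancel₀ _ hε.ne']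
        linarith [mul_nonneg hε.le hRs]

/-! ### Lorentzian signature of forms close to `η` -/

namespace Minkowski

/-- On the spatial hyperplane `{u⁰ = 0}` the Minkowski form is the Euclidean square norm,
`η(u, u) = ‖u‖²` (O'Neill 1983, Ch. 3, p. 55). [cite: ONeill1983, Ch. 3  p. 55] -/
theorem bilin_apply_self_of_apply_zero {u : E4} (hu : u 0 = 0) : bilin u u = ‖u‖ ^ 2 := by
  conv_rhs => rw [EuclideanSpace.real_norm_sq_eq, Fin.sum_univ_succ]
  rw [bilin_apply, hu]
  simp [pow_two]

/-- **Perturbative spatial positivity**: if `‖g − η‖ < 1` then `g(u, u) > 0` for every nonzero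
`u` in the spatial hyperplane `{u⁰ = 0}`, since `g(u,u) ≥ η(u,u) − ‖g − η‖ ‖u‖² = (1 − ‖g − η‖) ‖u‖²`.
O'Neill 1983, Ch. 5, Lemma 5.26 (perturbative form). [folklore] -/
theorem apply_self_pos_of_norm_sub_bilin_lt_one {g : E4 →L[ℝ] E4 →L[ℝ] ℝ} (hg : ‖g - bilin‖ < 1)
    {u : E4} (hu0 : u 0 = 0) (hu : u ≠ 0) : 0 < g u u := by
  have h1 : g u u = bilin u u + (g - bilin) u u := by
    simp only [sub_apply]; ring
  have h2 := (g - bilin).le_opNorm₂ u u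
  rw [Real.norm_eq_abs] at h2
  have h3 : 0 < ‖u‖ := norm_pos_iff.mpr hu
  have h4 : ‖g - bilin‖ * ‖u‖ * ‖u‖ < 1 * ‖u‖ * ‖u‖ := by gcongr
  rw [h1, bilin_apply_self_of_apply_zero hu0]
  nlinarith [(abs_le.mp h2).1]

/-- **Perturbative timelike axis**: if `‖g − η‖ < 1` then `g(∂ₜ, ∂ₜ) ≤ −1 + ‖g − η‖ < 0`.
O'Neill 1983, Ch. 5, Lemma 5.26 (perturbative form). [folklore] -/
theorem apply_basisVector_zero_neg_of_norm_sub_bilin_lt_one {g : E4 →L[ℝ] E4 →L[ℝ] ℝ}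
    (hg : ‖g - bilin‖ < 1) : g (E4.basisVector 0) (E4.basisVector 0) < 0 := by
  have h1 : g (E4.basisVector 0) (E4.basisVector 0) =
      -1 + (g - bilin) (E4.basisVector 0) (E4.basisVector 0) := by
    rw [sub_apply, sub_apply, bilin_basisVector_zero]
    ring
  have hn : ‖(E4.basisVector 0 : E4)‖ = 1 := by simp [E4.basisVector]
  have h2 := (g - bilin).le_opNorm₂ (E4.basisVector 0) (E4.basisVector 0)
  rw [hn, mul_one, mul_one, Real.norm_eq_abs] at h2
  rw [h1]
  linarith [(abs_le.mp h2).2]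

/-- **Index one from spatial positivity**: if a symmetric bilinear form `g` on `E4` is positive
definite on the spatial hyperplane `{u⁰ = 0}`, then the `g`-orthogonal complement of any
`g`-timelike vector is `g`-spacelike. (For `g(v,v) < 0`, `g(v,w) = 0`, `w ≠ 0`, the spatial vector
`u = w⁰ v − v⁰ w` has `g(u,u) = (w⁰)² g(v,v) + (v⁰)² g(w,w)`, which is positive unless `u = 0`.)
O'Neill 1983, Ch. 5, Lemma 5.26. [cite: ONeill1983, Ch. 5  Lemma 5.26] -/
theorem pos_of_orthogonal_of_spatial_pos {g : E4 →L[ℝ] E4 →L[ℝ] ℝ}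
    (hsymm : ∀ v w, g v w = g w v) (hS : ∀ u : E4, u 0 = 0 → u ≠ 0 → 0 < g u u) (v w : E4)
    (hv : g v v < 0) (hvw : g v w = 0) (hw : w ≠ 0) : 0 < g w w := by
  by_contra hww'
  have hww : g w w ≤ 0 := not_lt.mp hww'
  have hwv : g w v = 0 := (hsymm w v).trans hvw
  set u : E4 := w 0 • v - v 0 • w with hu
  have hu0 : u 0 = 0 := by simp [hu, mul_comm]
  have he : g u u = w 0 ^ 2 * g v v + v 0 ^ 2 * g w w := by
    simp only [hu, map_sub, map_smul, sub_apply, smul_apply, smul_eq_mul, hvw, hwv]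
    ring
  have hle : g u u ≤ 0 := by rw [he]; nlinarith [sq_nonneg (w 0), sq_nonneg (v 0)]
  by_cases hu' : u = 0
  · have h0 : w 0 ^ 2 * g v v + v 0 ^ 2 * g w w = 0 := by
      rw [← he, hu']
      simp
    have hw0sq : w 0 ^ 2 = 0 := by
      have h1 : w 0 ^ 2 * g v v = 0 := by nlinarith [sq_nonneg (w 0), sq_nonneg (v 0)]
      exact (mul_eq_zero.mp h1).resolve_right hv.ne
    have hw0 : w 0 = 0 := (pow_eq_zero_iff two_ne_zero).mp hw0sq
    have hv0w : v 0 • w = 0 := by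
      have h2 : u = -(v 0 • w) := by rw [hu, hw0, zero_smul, zero_sub]
      rw [hu'] at h2
      exact (neg_eq_zero.mp h2.symm)
    rcases smul_eq_zero.mp hv0w with hv0 | hw'
    · by_cases hvz : v = 0
      · rw [hvz] at hv
        simp at hv
      · exact (lt_asymm hv) (hS v hv0 hvz)
    · exact hw hw'
  · exact (not_lt.mpr hle) (hS u hu0 hu')

/-- **Nondegeneracy from spatial positivity**: a symmetric bilinear form on `E4`, positive definite
on `{u⁰ = 0}` and possessing a timelike vector `t`, is nondegenerate (apply
`pos_of_orthogonal_of_spatial_pos` to `t` and a vector in the radical).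
O'Neill 1983, Ch. 5, Lemma 5.26. [cite: ONeill1983, Ch. 5  Lemma 5.26] -/
theorem nondegenerate_of_spatial_pos {g : E4 →L[ℝ] E4 →L[ℝ] ℝ}
    (hsymm : ∀ v w, g v w = g w v) (hS : ∀ u : E4, u 0 = 0 → u ≠ 0 → 0 < g u u) {t : E4}
    (ht : g t t < 0) (v : E4) (hv : ∀ w, g v w = 0) : v = 0 := by
  by_contra hvz
  have h := pos_of_orthogonal_of_spatial_pos hsymm hS t v ht ((hsymm t v).trans (hv t)) hvz
  rw [hv v] at h
  exact lt_irrefl 0 h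

end Minkowski

/-! ### The superposition is a Lorentzian metric far from the centres -/

/-- The inverse Poincaré map `x ↦ Λ⁻¹(x − c)` is `C^n` for every `n ≤ ω` (an affine map).
O'Neill 1983, Ch. 9, p. 236. [cite: ONeill1983, Ch. 9  p. 236] -/
theorem contDiff_poincareInv (Λ : lorentzGroup) (c : E4) {n : WithTop ℕ∞} :
    ContDiff ℝ n (poincareInv Λ c) :=
  (Λ : E4 ≃L[ℝ] E4).symm.contDiff.comp (contDiff_id.sub contDiff_const)

/-- The boosted Kerr–Schild components `x ↦ g_{M,a,Λ,c}(x)` are `C^n` (every `n ≤ ω`) wherever the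
rest-frame radius is positive (`Kerr.contDiffAt_bilin` transported by the affine map).
Kerr–Schild 1965, §3; Matzner–Huq–Shoemaker 1998, §3 (15). [cite: KerrSchild1965, §3] -/
theorem contDiffAt_boostedKerrBilin (Λ : lorentzGroup) (c : E4) (M a : ℝ) {x : E4}
    (hx : 0 < Kerr.radius a (poincareInv Λ c x)) {n : WithTop ℕ∞} :
    ContDiffAt ℝ n (boostedKerrBilin Λ c M a) x := by
  have hK : ContDiffAt ℝ n (fun y ↦ Kerr.bilin M a (poincareInv Λ c y)) x :=
    (Kerr.contDiffAt_bilin M a hx).comp x (contDiff_poincareInv Λ c).contDiffAt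
  have h : ContDiffAt ℝ n (fun y ↦
      (ContinuousLinearMap.precomp ℝ ((Λ : E4 ≃L[ℝ] E4).symm : E4 →L[ℝ] E4)).comp
        ((Kerr.bilin M a (poincareInv Λ c y)).comp ((Λ : E4 ≃L[ℝ] E4).symm : E4 →L[ℝ] E4))) x :=
    contDiffAt_const.clm_comp (hK.clm_comp contDiffAt_const)
  exact h

/-- The superposed components `x ↦ g(x)` are `C^n` (every `n ≤ ω`) wherever all rest-frame radii
are positive (finite sum of `C^n` terms). Bonning et al. 2003, §3.3. [cite: BonningEtAl2003, §3.3] -/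
theorem contDiffAt_multiCentreKerrSchildBilin (mot : Fin N → lorentzGroup × E4) (M a : Fin N → ℝ)
    {x : E4} (hx : ∀ i, 0 < Kerr.radius (a i) (poincareInv (mot i).1 (mot i).2 x))
    {n : WithTop ℕ∞} : ContDiffAt ℝ n (multiCentreKerrSchildBilin mot M a) x := by
  have h : ContDiffAt ℝ n (fun y ↦ Minkowski.bilin +
      ∑ i, (boostedKerrBilin (mot i).1 (mot i).2 (M i) (a i) y - Minkowski.bilin)) x :=
    contDiffAt_const.add (ContDiffAt.sum fun i _ ↦
      (contDiffAt_boostedKerrBilin _ _ _ _ (hx i)).sub contDiffAt_const)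
  exact h

/-- **The superposed Kerr–Schild form is a real-analytic Lorentzian metric on the far domain**
`multiCentreFarDomain mot a ρ`, for any `ρ ≥ 0` past which `‖g − η‖ < 1` (such `ρ` exist:
`exists_forall_mem_multiCentreFarDomain_norm_sub_lt_one`): symmetric; nondegenerate, with `∂ₜ`
timelike and spacelike orthogonal complements of timelike vectors by the perturbative signature
lemmas of `Minkowski`; analytic components by `contDiffAt_multiCentreKerrSchildBilin` and the chart
calculus `OpensChart.contMDiffAt_bilinSection_iff`. Bonning et al. 2003, §3.3 (the superposed
background as a spacetime metric far from the holes); O'Neill 1983, Ch. 3, Def. 3.1. [cite: BonningEtAl2003, §3.3] -/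
def multiCentreKerrSchildMetric (mot : Fin N → lorentzGroup × E4) (M a : Fin N → ℝ) (ρ : ℝ)
    (hρ : 0 ≤ ρ) (h : ∀ x ∈ multiCentreFarDomain mot a ρ,
      ‖multiCentreKerrSchildBilin mot M a x - Minkowski.bilin‖ < 1) :
    LorentzianMetric 𝓘(ℝ, E4) ω (multiCentreFarDomain mot a ρ) where
  val y := multiCentreKerrSchildBilin mot M a y.1
  symm y v w := multiCentreKerrSchildBilin_symm mot M a y.1 v w
  nondegenerate y v hv :=
    Minkowski.nondegenerate_of_spatial_pos (multiCentreKerrSchildBilin_symm mot M a y.1)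
      (fun _ hu0 hu ↦ Minkowski.apply_self_pos_of_norm_sub_bilin_lt_one (h y.1 y.2) hu0 hu)
      (Minkowski.apply_basisVector_zero_neg_of_norm_sub_bilin_lt_one (h y.1 y.2)) v hv
  contMDiff y :=
    (OpensChart.contMDiffAt_bilinSection_iff y _ (multiCentreKerrSchildBilin mot M a)
      (fun _ ↦ rfl)).2
      (contDiffAt_multiCentreKerrSchildBilin mot M a fun i ↦ hρ.trans_lt (y.2 i))
  exists_timelike y :=
    ⟨E4.basisVector 0, Minkowski.apply_basisVector_zero_neg_of_norm_sub_bilin_lt_one (h y.1 y.2)⟩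
  pos_of_orthogonal y v w hv hvw hw :=
    Minkowski.pos_of_orthogonal_of_spatial_pos (multiCentreKerrSchildBilin_symm mot M a y.1)
      (fun _ hu0 hu ↦ Minkowski.apply_self_pos_of_norm_sub_bilin_lt_one (h y.1 y.2) hu0 hu)
      v w hv hvw hw

/-- The value of the far-domain metric is the superposed form (by definition). [cite: BonningEtAl2003, §3.3] -/
@[simp]
theorem multiCentreKerrSchildMetric_val (mot : Fin N → lorentzGroup × E4) (M a : Fin N → ℝ)
    (ρ : ℝ) (hρ : 0 ≤ ρ) (h : ∀ x ∈ multiCentreFarDomain mot a ρ,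
      ‖multiCentreKerrSchildBilin mot M a x - Minkowski.bilin‖ < 1)
    (y : multiCentreFarDomain mot a ρ) :
    (multiCentreKerrSchildMetric mot M a ρ hρ h).val y = multiCentreKerrSchildBilin mot M a y.1 :=
  rfl

/-- **Existence of a Lorentzian far domain**: there is `ρ₀ > 0` with `‖g(x) − η‖ < 1` on
`multiCentreFarDomain mot a ρ₀`, so that `multiCentreKerrSchildMetric mot M a ρ₀` is defined: the
superposition is Lorentzian outside tubes of radius `ρ₀` around the centres, uniformly in time and
with no hypothesis on the motions. Bonning et al. 2003, §3.3. [cite: BonningEtAl2003, §3.3] -/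
theorem exists_forall_mem_multiCentreFarDomain_norm_sub_lt_one (mot : Fin N → lorentzGroup × E4)
    (M a : Fin N → ℝ) :
    ∃ ρ₀ : ℝ, 0 < ρ₀ ∧ ∀ x ∈ multiCentreFarDomain mot a ρ₀,
      ‖multiCentreKerrSchildBilin mot M a x - Minkowski.bilin‖ < 1 := by
  obtain ⟨ρ₀, h0, h⟩ := exists_norm_multiCentreKerrSchildBilin_sub_minkowski_le mot M a one_half_pos
  exact ⟨ρ₀, h0, fun x hx ↦ (h x hx).trans_lt one_half_lt_one⟩

/-- **Late-time form**: given excision radii `ρᵢ(t) → ∞` (e.g. sublinear, `ρᵢ = o(t)`, as in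
`FinalStateDecomposition`), there is a time `T` after which the superposed form satisfies
`‖g(x) − η‖ < 1` — hence is a Lorentzian scalar product, by the `Minkowski` signature lemmas — at
every point `x` with `x⁰ ≥ T` outside the tubes `{rᵢ(Λᵢ⁻¹(x − cᵢ)) < ρᵢ(x⁰)}`. No hypothesis on the
4-velocities is needed. Bonning et al. 2003, §3.3. [cite: BonningEtAl2003, §3.3] -/
theorem exists_forall_norm_sub_minkowski_lt_one_of_tendsto (mot : Fin N → lorentzGroup × E4)
    (M a : Fin N → ℝ) (ρ : Fin N → ℝ → ℝ) (hρ : ∀ i, Tendsto (ρ i) atTop atTop) :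
    ∃ T : ℝ, ∀ x : E4, T ≤ x 0 →
      (∀ i, ρ i (x 0) ≤ Kerr.radius (a i) (poincareInv (mot i).1 (mot i).2 x)) →
        ‖multiCentreKerrSchildBilin mot M a x - Minkowski.bilin‖ < 1 := by
  obtain ⟨ρ₀, -, h⟩ := exists_forall_mem_multiCentreFarDomain_norm_sub_lt_one mot M a
  have hev : ∀ᶠ t in atTop, ∀ i, ρ₀ < ρ i t :=
    eventually_all.2 fun i ↦ (hρ i).eventually_gt_atTop ρ₀
  obtain ⟨T, hT⟩ := eventually_atTop.1 hev
  exact ⟨T, fun x hx hr ↦ h x fun i ↦ (hT (x 0) hx i).trans_le (hr i)⟩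

end Literature.Geometry.Lorentzian

end
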